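import Literature.AnabelianGeometry.SemiGraphs.GraphOfAnabelioidsImages
import Literature.AnabelianGeometry.SemiGraphs.PullbackFunctorExact
import Literature.AnabelianGeometry.Anabelioids.ExactFunctorProofs

/-!
# `B(𝒢)` is a connected anabelioid ([SemiAnbd] Definition 2.1, p. 23) — proof

Proof-only companion of `GraphOfAnabelioids.lean`, discharging the named fact
`bOf_galoisCategory`: for a *connected* semi-graph of anabelioids `𝒢`, the category `B(𝒢)` of
systems `{S_v, T_e, ψ_b : b^* S_v ⥲ T_e}` is a Galois category (Mathlib `GaloisCategory`), and
for every vertex `v` and basepoint `β` of `𝒢_v` the composite `ρ_v ⋙ β` is a basepoint (fibre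
functor) of `B(𝒢)` ("one verifies immediately that this category `B(𝒢)` is a connected
anabelioid", "natural outer homomorphisms `Π_v → Π_𝒢`").

Assembly of: (co)limits componentwise (`GraphOfAnabelioidsLimits`), complements (G3)
(`GraphOfAnabelioidsComplements`), fibre-surjectivity of epimorphisms (G5)
(`GraphOfAnabelioidsImages`), and conservativity (G6), proved here: an isomorphism at one
vertex (or edge) propagates to all components along the barycentric subdivision of the
connected underlying semi-graph, using that the exact pull-back functors `b^*` reflect
isomorphisms (`Anabelioids.reflectsIsomorphisms_of_exact`).  The vertexless connected case (a
single edge) is covered by the basepoints through an edge (`fiberFunctor_ρE`).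
-/

namespace Literature.AnabelianGeometry.SemiGraphs

open CategoryTheory CategoryTheory.Limits CategoryTheory.PreGaloisCategory
open Literature.AnabelianGeometry.Anabelioids

universe w v₁ u₁ u

namespace SemiGraphOfAnabelioids

variable (𝒢 : SemiGraphOfAnabelioids.{v₁, u₁, u})

variable {𝒢} in
/-- Propagation of invertibility along the barycentric subdivision: for a morphism `f` of `B(𝒢)`,
"the component of `f` at the node is an isomorphism" is invariant under adjacency (a vertex `v`
and a branch `b ∈ e` abutting to it: `f_e ≅ b^* f_v` via the gluing isomorphisms, and `b^*` is
exact hence conservative). [cite: MochizukiSemiAnbd2006, Def. 2.1 p.23] -/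
theorem isIso_node_iff_of_reachable {X Y : 𝒢.BObj} (f : X ⟶ Y) (x y : 𝒢.graph.Node)
    (hxy : 𝒢.graph.subdivision.Reachable x y) :
    Sum.elim (fun v => IsIso (f.fS v))
        (Sum.elim (fun e => IsIso (f.fT e)) (fun b => IsIso (f.fT (𝒢.graph.edgeOf b)))) x ↔
      Sum.elim (fun v => IsIso (f.fS v))
        (Sum.elim (fun e => IsIso (f.fT e)) (fun b => IsIso (f.fT (𝒢.graph.edgeOf b)))) y := by
  -- one step along an incidence
  have step : ∀ x y : 𝒢.graph.Node, 𝒢.graph.NodeRel x y →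
      (Sum.elim (fun v => IsIso (f.fS v))
        (Sum.elim (fun e => IsIso (f.fT e)) (fun b => IsIso (f.fT (𝒢.graph.edgeOf b)))) x ↔
      Sum.elim (fun v => IsIso (f.fS v))
        (Sum.elim (fun e => IsIso (f.fT e)) (fun b => IsIso (f.fT (𝒢.graph.edgeOf b)))) y) := by
    rintro _ _ ⟨b⟩
    · exact Iff.rfl
    · rename_i b v h
      change IsIso (f.fT (𝒢.graph.edgeOf b)) ↔ IsIso (f.fS v)
      have hcomm := f.comm b v h
      constructor
      · intro hT
        haveI := reflectsIsomorphisms_of_exact (𝒢.pull b v h).pullback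
        have : IsIso ((𝒢.pull b v h).pullback.map (f.fS v)) := by
          have heq : (𝒢.pull b v h).pullback.map (f.fS v) =
              (X.ψ b v h).hom ≫ f.fT (𝒢.graph.edgeOf b) ≫ (Y.ψ b v h).inv := by
            rw [← Category.assoc, ← hcomm, Category.assoc, Iso.hom_inv_id, Category.comp_id]
          rw [heq]
          infer_instance
        exact isIso_of_reflects_iso (f.fS v) (𝒢.pull b v h).pullback
      · intro hS
        have heq : f.fT (𝒢.graph.edgeOf b) =
            (X.ψ b v h).inv ≫ (𝒢.pull b v h).pullback.map (f.fS v) ≫ (Y.ψ b v h).hom := by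
          rw [hcomm, Iso.inv_hom_id_assoc]
        rw [heq]
        infer_instance
  rw [SimpleGraph.reachable_iff_reflTransGen] at hxy
  induction hxy with
  | refl => exact Iff.rfl
  | tail _ hadj ih =>
    refine ih.trans ?_
    rw [SemiGraph.subdivision, SimpleGraph.fromRel_adj] at hadj
    rcases hadj.2 with h | h
    · exact step _ _ h
    · exact (step _ _ h).symm

variable {𝒢} in
/-- For connected `𝒢`: a morphism of `B(𝒢)` which is an isomorphism at one vertex is an
isomorphism. [cite: MochizukiSemiAnbd2006, Def. 2.1 p.23] -/
theorem isIso_of_isIso_vertex (h𝒢 : 𝒢.IsConnected) {X Y : 𝒢.BObj} (f : X ⟶ Y)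
    (v₀ : 𝒢.graph.Vertex) (h : IsIso (f.fS v₀)) : IsIso f := by
  have hc := h𝒢.isConnected.connected
  refine BObj.isIso_of_components f (fun v => ?_) (fun e => ?_)
  · exact (isIso_node_iff_of_reachable f (Sum.inl v₀) (Sum.inl v) (hc.preconnected _ _)).mp h
  · exact (isIso_node_iff_of_reachable f (Sum.inl v₀) (Sum.inr (Sum.inl e))
      (hc.preconnected _ _)).mp h

variable {𝒢} in
/-- For connected `𝒢`: a morphism of `B(𝒢)` which is an isomorphism at one edge is an
isomorphism. [cite: MochizukiSemiAnbd2006, Def. 2.1 p.23] -/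
theorem isIso_of_isIso_edge (h𝒢 : 𝒢.IsConnected) {X Y : 𝒢.BObj} (f : X ⟶ Y)
    (e₀ : 𝒢.graph.Edge) (h : IsIso (f.fT e₀)) : IsIso f := by
  have hc := h𝒢.isConnected.connected
  refine BObj.isIso_of_components f (fun v => ?_) (fun e => ?_)
  · exact (isIso_node_iff_of_reachable f (Sum.inr (Sum.inl e₀)) (Sum.inl v)
      (hc.preconnected _ _)).mp h
  · exact (isIso_node_iff_of_reachable f (Sum.inr (Sum.inl e₀)) (Sum.inr (Sum.inl e))
      (hc.preconnected _ _)).mp h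

/-- The pull-back functors `b^*` preserve quotients by finite groups in any universe (they are
exact). [cite: MochizukiSemiAnbd2006, Def. 2.1 p.22] -/
theorem preservesColimitsOfShape_singleObj_pull (G : Type w) [Group G] [Finite G]
    (b : 𝒢.graph.Branch) (v : 𝒢.graph.Vertex) (h : 𝒢.graph.abuts b = some v) :
    PreservesColimitsOfShape (SingleObj G) (𝒢.pull b v h).pullback := by
  obtain ⟨G', hg, hf, ⟨e⟩⟩ := Finite.exists_type_univ_nonempty_mulEquiv.{w, 0} G
  have : PreservesColimitsOfShape (SingleObj G') (𝒢.pull b v h).pullback := inferInstance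
  exact preservesColimitsOfShape_of_equiv e.toSingleObjEquiv.symm _

/-- **`B(𝒢)` is a pre-Galois category** (axioms (G1)–(G3)), for any semi-graph of anabelioids.
[cite: MochizukiSemiAnbd2006, Def. 2.1 p.23] -/
theorem preGaloisCategory_bObj : PreGaloisCategory 𝒢.BObj where
  hasTerminal := (𝒢.hasLimitsOfShape_bObj (J := Discrete PEmpty.{1})).1
  hasPullbacks := (𝒢.hasLimitsOfShape_bObj (J := WalkingCospan)).1
  hasFiniteCoproducts := ⟨fun n => (𝒢.hasColimitsOfShape_bObj (J := Discrete (Fin n))).1⟩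
  hasQuotientsByFiniteGroups G _ _ := by
    haveI := 𝒢.preservesColimitsOfShape_singleObj_pull G
    exact (𝒢.hasColimitsOfShape_bObj (J := SingleObj G)).1
  monoInducesIsoOnDirectSummand i _ := 𝒢.exists_complement i

/-- **The basepoints of `B(𝒢)` through a vertex** ([SemiAnbd] p. 23: "`Π_𝒢 := π̂₁(B(𝒢))` …
natural outer homomorphisms `Π_v → Π_𝒢`"): for connected `𝒢`, a vertex `v` and a basepoint `β`
of `𝒢_v`, the functor `ρ_v ⋙ β` is a fibre functor of `B(𝒢)`.
[cite: MochizukiSemiAnbd2006, Def. 2.1 p.23] -/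
theorem fiberFunctor_ρ (h𝒢 : 𝒢.IsConnected) (v : 𝒢.graph.Vertex) (F : 𝒢.V v ⥤ FintypeCat.{w})
    [FiberFunctor F] :
    letI := 𝒢.preGaloisCategory_bObj
    FiberFunctor (𝒢.ρ v ⋙ F) := by
  letI := 𝒢.preGaloisCategory_bObj
  have h1 := (𝒢.hasLimitsOfShape_bObj (J := Discrete PEmpty.{1})).2.1 v
  have h2 := (𝒢.hasLimitsOfShape_bObj (J := WalkingCospan)).2.1 v
  exact {
    preservesTerminalObjects := inferInstance
    preservesPullbacks := inferInstance
    preservesFiniteCoproducts := ⟨fun n => by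
      have := (𝒢.hasColimitsOfShape_bObj (J := Discrete (Fin n))).2.1 v
      infer_instance⟩
    preservesEpis := ⟨fun f _ =>
      ConcreteCategory.epi_of_surjective _ ((𝒢.surjective_fiber_of_epi f).1 v F)⟩
    preservesQuotientsByFiniteGroups := fun G _ _ => by
      haveI := 𝒢.preservesColimitsOfShape_singleObj_pull G
      have := (𝒢.hasColimitsOfShape_bObj (J := SingleObj G)).2.1 v
      infer_instance
    reflectsIsos := ⟨fun f hf => by
      haveI : IsIso (F.map ((𝒢.ρ v).map f)) := hf
      exact isIso_of_isIso_vertex h𝒢 f v (isIso_of_reflects_iso ((𝒢.ρ v).map f) F)⟩ }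

/-- The basepoints of `B(𝒢)` through an edge: for connected `𝒢`, an edge `e` and a basepoint `β`
of `𝒢_e`, the functor `ρ_e ⋙ β` is a fibre functor of `B(𝒢)` (this also covers the connected
semi-graphs without vertices, i.e. a single edge). [cite: MochizukiSemiAnbd2006, Def. 2.1 p.23] -/
theorem fiberFunctor_ρE (h𝒢 : 𝒢.IsConnected) (e : 𝒢.graph.Edge) (F : 𝒢.E e ⥤ FintypeCat.{w})
    [FiberFunctor F] :
    letI := 𝒢.preGaloisCategory_bObj
    FiberFunctor (𝒢.ρE e ⋙ F) := by
  letI := 𝒢.preGaloisCategory_bObj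
  have h1 := (𝒢.hasLimitsOfShape_bObj (J := Discrete PEmpty.{1})).2.2 e
  have h2 := (𝒢.hasLimitsOfShape_bObj (J := WalkingCospan)).2.2 e
  exact {
    preservesTerminalObjects := inferInstance
    preservesPullbacks := inferInstance
    preservesFiniteCoproducts := ⟨fun n => by
      have := (𝒢.hasColimitsOfShape_bObj (J := Discrete (Fin n))).2.2 e
      infer_instance⟩
    preservesEpis := ⟨fun f _ =>
      ConcreteCategory.epi_of_surjective _ ((𝒢.surjective_fiber_of_epi f).2 e F)⟩
    preservesQuotientsByFiniteGroups := fun G _ _ => by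
      haveI := 𝒢.preservesColimitsOfShape_singleObj_pull G
      have := (𝒢.hasColimitsOfShape_bObj (J := SingleObj G)).2.2 e
      infer_instance
    reflectsIsos := ⟨fun f hf => by
      haveI : IsIso (F.map ((𝒢.ρE e).map f)) := hf
      exact isIso_of_isIso_edge h𝒢 f e (isIso_of_reflects_iso ((𝒢.ρE e).map f) F)⟩ }

/-- **`B(𝒢)` is a Galois category** for connected `𝒢`. [cite: MochizukiSemiAnbd2006, Def. 2.1 p.23] -/
theorem galoisCategory_bObj (h𝒢 : 𝒢.IsConnected) : GaloisCategory 𝒢.BObj := by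
  letI := 𝒢.preGaloisCategory_bObj
  -- a basepoint: through a vertex if there is one, through an edge otherwise
  have hF : ∃ F : 𝒢.BObj ⥤ FintypeCat.{max u v₁}, Nonempty (FiberFunctor F) := by
    obtain ⟨x⟩ := h𝒢.isConnected.connected.nonempty
    rcases x with v | e | b
    · haveI := 𝒢.fiberFunctor_ρ h𝒢 v (GaloisCategory.getFiberFunctor (𝒢.V v))
      exact ⟨(𝒢.ρ v ⋙ GaloisCategory.getFiberFunctor (𝒢.V v)) ⋙ FintypeCat.uSwitch.{v₁, max u v₁},
        ⟨FiberFunctor.comp_right _⟩⟩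
    · haveI := 𝒢.fiberFunctor_ρE h𝒢 e (GaloisCategory.getFiberFunctor (𝒢.E e))
      exact ⟨(𝒢.ρE e ⋙ GaloisCategory.getFiberFunctor (𝒢.E e)) ⋙ FintypeCat.uSwitch.{v₁, max u v₁},
        ⟨FiberFunctor.comp_right _⟩⟩
    · haveI := 𝒢.fiberFunctor_ρE h𝒢 (𝒢.graph.edgeOf b)
        (GaloisCategory.getFiberFunctor (𝒢.E (𝒢.graph.edgeOf b)))
      exact ⟨(𝒢.ρE (𝒢.graph.edgeOf b) ⋙ GaloisCategory.getFiberFunctor _) ⋙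
        FintypeCat.uSwitch.{v₁, max u v₁}, ⟨FiberFunctor.comp_right _⟩⟩
  exact { hasFiberFunctor := hF }

/-- **[SemiAnbd] Definition 2.1, p. 23: "one verifies immediately that this category `B(𝒢)` is a
connected anabelioid"** — discharge of the named fact `bOf_galoisCategory`: for a connected
semi-graph of anabelioids `𝒢`, `B(𝒢)` is a Galois category and the basepoints through the
vertices, `ρ_v ⋙ β`, are fibre functors. [cite: MochizukiSemiAnbd2006, Def. 2.1 p.23] -/
theorem bOf_galoisCategory_holds : bOf_galoisCategory.{v₁, u₁, u} := by
  intro 𝒢 h𝒢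
  exact ⟨𝒢.galoisCategory_bObj h𝒢, fun v F _ => ⟨𝒢.fiberFunctor_ρ h𝒢 v F⟩⟩

end SemiGraphOfAnabelioids

end Literature.AnabelianGeometry.SemiGraphs
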